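import Summits.RiemannHypothesis.RiemannHypothesis.Theorems.WeilFormatCDefs
import Summits.RiemannHypothesis.RiemannHypothesis.Theorems.WeilFormatCWindowLimit
import HarnessLib

/-!
# Format C (Fourier–Galerkin certificates of Weil positivity): the sesquilinear window form —
  window-function calculus, hermitian symmetry, linearity

Helper file (`--supports stmt-RiemannHypothesis-0098`, lead-track anchor), RH-free. Seat
rh-explicit-weil-3 (gen3). Objects of `WeilFormatCDefs.lean` (`IsWindowFunction`, `weilIncrementSesq`,
`weilPoleSesq`, `weilWindowSesq`), bounds of `WeilFormatCWindowFamily/Limit.lean`.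

## Contents (sorry-free)

* closure of window functions under `+`, scalars and finite sums; integrability of the products and
  increment products of window functions; `|D_t(u,v)| ≤ (D_t(u) + D_t(v))/2`; measurability of
  `t ↦ D_t(u,v)` and integrability of `w(t) D_t(u,v)` on `(0,∞)`;
* the diagonal is the window form: `weilWindowSesq a u u = weilWindowForm a u` (no hypothesis);
* hermitian symmetry `weilWindowSesq a v u = conj (weilWindowSesq a u v)` (no hypothesis);
* linearity in the first argument: `weilWindowSesq a (c • u) v = c · weilWindowSesq a u v` (no
  hypothesis) and `weilWindowSesq a (u₁ + u₂) v = weilWindowSesq a u₁ v + weilWindowSesq a u₂ v` for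
  window functions.

The finite-sum expansion `weilWindowForm a (Σ c_n u_n) = Re Σ c_m conj(c_n) weilWindowSesq a u_m u_n`
and its specialisation to Yoshida's `χ_n` are the sequel `WeilFormatCWindowGram.lean`.
-/

set_option autoImplicit false
set_option linter.dupNamespace false  -- the mandated namespace repeats `RiemannHypothesis`

noncomputable section

open Complex Filter Set MeasureTheory
open scoped Real Topology ComplexConjugate ArithmeticFunction.vonMangoldt

namespace Summit.RiemannHypothesis.RiemannHypothesis.Theorems.WeilFormatC

open Literature.NumberTheory.LFunctions

variable {a : ℝ} {u v u₁ u₂ : ℝ → ℂ}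

/-! ## Window functions: closure properties and integrability -/

namespace IsWindowFunction

/-- The zero function is a window function. -/
theorem zero (a : ℝ) : IsWindowFunction a (0 : ℝ → ℂ) :=
  ⟨measurable_const, fun _ _ ↦ rfl, ⟨0, fun _ ↦ by simp⟩, ⟨0, fun _ _ _ _ ↦ by simp⟩⟩

/-- Window functions are closed under addition. -/
theorem add (hu : IsWindowFunction a u) (hv : IsWindowFunction a v) : IsWindowFunction a (u + v) := by
  obtain ⟨Su, hSu⟩ := hu.bounded
  obtain ⟨Sv, hSv⟩ := hv.bounded
  obtain ⟨Lu, hLu⟩ := hu.lipschitz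
  obtain ⟨Lv, hLv⟩ := hv.lipschitz
  refine ⟨hu.measurable.add hv.measurable, fun x hx ↦ by simp [hu.eq_zero x hx, hv.eq_zero x hx],
    ⟨Su + Sv, fun x ↦ (norm_add_le _ _).trans (add_le_add (hSu x) (hSv x))⟩,
    ⟨Lu + Lv, fun x y hx hy ↦ ?_⟩⟩
  calc ‖(u + v) y - (u + v) x‖ = ‖(u y - u x) + (v y - v x)‖ := by simp only [Pi.add_apply]; ring_nf
    _ ≤ ‖u y - u x‖ + ‖v y - v x‖ := norm_add_le _ _
    _ ≤ Lu * |y - x| + Lv * |y - x| := add_le_add (hLu x y hx hy) (hLv x y hx hy)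
    _ = (Lu + Lv) * |y - x| := by ring

/-- Window functions are closed under scalar multiplication. -/
theorem smul (hu : IsWindowFunction a u) (c : ℂ) : IsWindowFunction a (c • u) := by
  obtain ⟨S, hS⟩ := hu.bounded
  obtain ⟨L, hL⟩ := hu.lipschitz
  refine ⟨hu.measurable.const_smul c, fun x hx ↦ by simp [hu.eq_zero x hx],
    ⟨‖c‖ * S, fun x ↦ ?_⟩, ⟨‖c‖ * L, fun x y hx hy ↦ ?_⟩⟩
  · rw [Pi.smul_apply, smul_eq_mul, norm_mul]
    exact mul_le_mul_of_nonneg_left (hS x) (norm_nonneg _)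
  · rw [Pi.smul_apply, Pi.smul_apply, smul_eq_mul, smul_eq_mul, ← mul_sub, norm_mul, mul_assoc]
    exact mul_le_mul_of_nonneg_left (hL x y hx hy) (norm_nonneg _)

/-- Finite linear combinations of window functions are window functions. -/
theorem sum {ι : Type*} (s : Finset ι) {f : ι → ℝ → ℂ} (c : ι → ℂ)
    (h : ∀ i ∈ s, IsWindowFunction a (f i)) : IsWindowFunction a (∑ i ∈ s, c i • f i) := by
  classical
  induction s using Finset.induction_on with
  | empty => simpa using zero a
  | insert i s hi ih =>
    rw [Finset.sum_insert hi]
    exact (smul (h i (Finset.mem_insert_self i s)) (c i)).add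
      (ih fun j hj ↦ h j (Finset.mem_insert_of_mem hj))

/-- A window function has a non-negative bound. -/
theorem bounded' (hu : IsWindowFunction a u) : ∃ S : ℝ, 0 ≤ S ∧ ∀ x, ‖u x‖ ≤ S := by
  obtain ⟨S, hS⟩ := hu.bounded
  exact ⟨S, (norm_nonneg _).trans (hS 0), hS⟩

/-- A window function times a continuous weight is integrable. -/
theorem integrable_mul_continuous (hu : IsWindowFunction a u) {w : ℝ → ℂ} (hw : Continuous w) :
    Integrable fun x ↦ u x * w x := by
  obtain ⟨S, hS0, hS⟩ := hu.bounded'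
  have hint : Integrable fun x ↦ (Icc (-a) a).indicator (fun x ↦ S * ‖w x‖) x :=
    (integrable_indicator_iff measurableSet_Icc).2
      ((continuous_const.mul hw.norm).continuousOn.integrableOn_Icc)
  refine hint.mono' ((hu.measurable.mul hw.measurable).aestronglyMeasurable)
    (Eventually.of_forall fun x ↦ ?_)
  by_cases hx : x ∈ Icc (-a) a
  · rw [indicator_of_mem hx, norm_mul]
    exact mul_le_mul_of_nonneg_right (hS x) (norm_nonneg _)
  · rw [hu.eq_zero x hx, indicator_of_notMem hx, zero_mul, norm_zero]

/-- The product `u · conj v` of two window functions is integrable. -/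
theorem integrable_mul_conj (hu : IsWindowFunction a u) (hv : IsWindowFunction a v) :
    Integrable fun x ↦ u x * conj (v x) := by
  obtain ⟨S, hS0, hS⟩ := hu.bounded'
  obtain ⟨T, hT0, hT⟩ := hv.bounded'
  have hint : Integrable fun x ↦ (Icc (-a) a).indicator (fun _ ↦ S * T) x :=
    (integrable_indicator_iff measurableSet_Icc).2 (integrableOn_const (by simp [Real.volume_Icc]))
  refine hint.mono' ((hu.measurable.mul (Complex.continuous_conj.measurable.comp hv.measurable))
    |>.aestronglyMeasurable) (Eventually.of_forall fun x ↦ ?_)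
  by_cases hx : x ∈ Icc (-a) a
  · rw [indicator_of_mem hx, norm_mul, Complex.norm_conj]
    exact mul_le_mul (hS x) (hT x) (norm_nonneg _) hS0
  · rw [hu.eq_zero x hx, indicator_of_notMem hx, zero_mul, norm_zero]

/-- The increment `x ↦ u(x+t) − u(x)` of a window function is measurable, bounded by twice the bound,
and vanishes off `[-a - |t|, a + |t|]`. -/
theorem shift_sub (hu : IsWindowFunction a u) (t : ℝ) :
    Measurable (fun x ↦ u (x + t) - u x) ∧
      (∀ x, x ∉ Icc (-a - |t|) (a + |t|) → u (x + t) - u x = 0) ∧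
      ∃ S : ℝ, 0 ≤ S ∧ ∀ x, ‖u (x + t) - u x‖ ≤ S := by
  obtain ⟨S, hS0, hS⟩ := hu.bounded'
  refine ⟨(hu.measurable.comp (measurable_id.add_const t)).sub hu.measurable, fun x hx ↦ ?_,
    ⟨S + S, by positivity, fun x ↦ (norm_sub_le _ _).trans (add_le_add (hS _) (hS _))⟩⟩
  rw [mem_Icc, not_and_or, not_le, not_le] at hx
  have hx1 : x ∉ Icc (-a) a := by
    intro h; rcases hx with h' | h' <;> linarith [h.1, h.2, abs_nonneg t]
  have hx2 : x + t ∉ Icc (-a) a := by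
    intro h; rcases hx with h' | h' <;> linarith [h.1, h.2, le_abs_self t, neg_abs_le t]
  rw [hu.eq_zero _ hx1, hu.eq_zero _ hx2, sub_zero]

/-- The sesquilinear increment integrand of two window functions is integrable. -/
theorem integrable_incrementSesq (hu : IsWindowFunction a u) (hv : IsWindowFunction a v) (t : ℝ) :
    Integrable fun x ↦ (u (x + t) - u x) * conj (v (x + t) - v x) := by
  obtain ⟨hmE, hzE, S, hS0, hS⟩ := hu.shift_sub t
  obtain ⟨hmF, -, T, hT0, hT⟩ := hv.shift_sub t
  have hint : Integrable fun x ↦ (Icc (-a - |t|) (a + |t|)).indicator (fun _ ↦ S * T) x :=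
    (integrable_indicator_iff measurableSet_Icc).2 (integrableOn_const (by simp [Real.volume_Icc]))
  refine hint.mono' ((hmE.mul (Complex.continuous_conj.measurable.comp hmF)).aestronglyMeasurable)
    (Eventually.of_forall fun x ↦ ?_)
  by_cases hx : x ∈ Icc (-a - |t|) (a + |t|)
  · rw [indicator_of_mem hx, norm_mul, Complex.norm_conj]
    exact mul_le_mul (hS x) (hT x) (norm_nonneg _) hS0
  · rw [hzE x hx, indicator_of_notMem hx, zero_mul, norm_zero]

/-- The archimedean energy `t ↦ w(t) D_t(u)` of a window function is integrable on `(0, ∞)`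
(`integrableOn_weilArchDensity_mul_weilIncrement_window` of `WeilFormatCWindowLimit.lean`, `a ≥ 0`). -/
theorem integrableOn_arch (ha : 0 ≤ a) (hu : IsWindowFunction a u) :
    IntegrableOn (fun t ↦ weilArchDensity t * weilIncrement u t) (Ioi 0) := by
  obtain ⟨S, hS⟩ := hu.bounded
  obtain ⟨L, hL⟩ := hu.lipschitz
  exact integrableOn_weilArchDensity_mul_weilIncrement_window ha hu.measurable hu.eq_zero hS hL

end IsWindowFunction

/-! ## The sesquilinear increment -/

/-- `|z conj w| ≤ (|z|² + |w|²)/2`. -/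
private theorem norm_mul_conj_le (z w : ℂ) : ‖z * conj w‖ ≤ (‖z‖ ^ 2 + ‖w‖ ^ 2) / 2 := by
  rw [norm_mul, Complex.norm_conj]
  nlinarith [sq_nonneg (‖z‖ - ‖w‖)]

/-- `‖D_t(u, v)‖ ≤ (D_t(u) + D_t(v))/2` for window functions. -/
theorem norm_weilIncrementSesq_le (hu : IsWindowFunction a u) (hv : IsWindowFunction a v) (t : ℝ) :
    ‖weilIncrementSesq u v t‖ ≤ (weilIncrement u t + weilIncrement v t) / 2 := by
  obtain ⟨S, hS⟩ := hu.bounded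
  obtain ⟨T, hT⟩ := hv.bounded
  unfold weilIncrementSesq weilIncrement
  have hIu := integrable_norm_sub_sq_window hu.measurable hu.eq_zero hS t
  have hIv := integrable_norm_sub_sq_window hv.measurable hv.eq_zero hT t
  calc ‖∫ x, (u (x + t) - u x) * conj (v (x + t) - v x)‖
      ≤ ∫ x, ‖(u (x + t) - u x) * conj (v (x + t) - v x)‖ := norm_integral_le_integral_norm _
    _ ≤ ∫ x, (‖u (x + t) - u x‖ ^ 2 + ‖v (x + t) - v x‖ ^ 2) / 2 :=
        integral_mono_of_nonneg (Eventually.of_forall fun x ↦ norm_nonneg _)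
          ((hIu.add hIv).div_const 2) (Eventually.of_forall fun x ↦ norm_mul_conj_le _ _)
    _ = ((∫ x, ‖u (x + t) - u x‖ ^ 2) + ∫ x, ‖v (x + t) - v x‖ ^ 2) / 2 := by
        rw [integral_div, integral_add hIu hIv]

/-- `t ↦ D_t(u, v)` is measurable for measurable `u, v` (a parametric Bochner integral). -/
theorem measurable_weilIncrementSesq (hu : Measurable u) (hv : Measurable v) :
    Measurable (weilIncrementSesq u v) := by
  have h : Measurable (Function.uncurry fun t x : ℝ ↦ (u (x + t) - u x) * conj (v (x + t) - v x)) := by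
    have h1 : Measurable fun p : ℝ × ℝ ↦ u (p.2 + p.1) := hu.comp (measurable_snd.add measurable_fst)
    have h2 : Measurable fun p : ℝ × ℝ ↦ u p.2 := hu.comp measurable_snd
    have h3 : Measurable fun p : ℝ × ℝ ↦ v (p.2 + p.1) := hv.comp (measurable_snd.add measurable_fst)
    have h4 : Measurable fun p : ℝ × ℝ ↦ v p.2 := hv.comp measurable_snd
    exact (h1.sub h2).mul (Complex.continuous_conj.measurable.comp (h3.sub h4))
  exact (h.stronglyMeasurable.integral_prod_right (ν := volume)).measurable

/-- The archimedean part of the sesquilinear energy converges absolutely for window functions: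
`t ↦ w(t) D_t(u, v)` is integrable on `(0, ∞)` (`a ≥ 0`). -/
theorem integrableOn_weilArchDensity_mul_weilIncrementSesq (ha : 0 ≤ a) (hu : IsWindowFunction a u)
    (hv : IsWindowFunction a v) :
    IntegrableOn (fun t ↦ (weilArchDensity t : ℂ) * weilIncrementSesq u v t) (Ioi 0) := by
  have hI : IntegrableOn (fun t ↦ (weilArchDensity t * weilIncrement u t +
      weilArchDensity t * weilIncrement v t) / 2) (Ioi 0) :=
    ((hu.integrableOn_arch ha).add (hv.integrableOn_arch ha)).div_const 2
  refine hI.mono' ?_ ?_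
  · exact ((Complex.continuous_ofReal.measurable.comp measurable_weilArchDensity).mul
      (measurable_weilIncrementSesq hu.measurable hv.measurable)).aestronglyMeasurable
  · refine (ae_restrict_iff' measurableSet_Ioi).2 (Eventually.of_forall fun t ht ↦ ?_)
    rw [norm_mul, Complex.norm_real, Real.norm_of_nonneg (weilArchDensity_pos ht).le]
    calc weilArchDensity t * ‖weilIncrementSesq u v t‖
        ≤ weilArchDensity t * ((weilIncrement u t + weilIncrement v t) / 2) :=
          mul_le_mul_of_nonneg_left (norm_weilIncrementSesq_le hu hv t) (weilArchDensity_pos ht).le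
      _ = (weilArchDensity t * weilIncrement u t + weilArchDensity t * weilIncrement v t) / 2 := by
          ring

/-! ## The diagonal is the window form; hermitian symmetry -/

/-- `z · conj z = |z|²` as a cast real. -/
private theorem mul_conj_eq_norm_sq (z : ℂ) : z * conj z = ((‖z‖ ^ 2 : ℝ) : ℂ) := by
  rw [Complex.mul_conj, Complex.normSq_eq_norm_sq]

/-- `D_t(u, u) = D_t(u)`. -/
theorem weilIncrementSesq_self (u : ℝ → ℂ) (t : ℝ) :
    weilIncrementSesq u u t = (weilIncrement u t : ℂ) := by
  unfold weilIncrementSesq weilIncrement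
  rw [← integral_complex_ofReal]
  exact integral_congr_ae (Eventually.of_forall fun x ↦ mul_conj_eq_norm_sq _)

/-- `P(u, u) = P(u)`. -/
theorem weilPoleSesq_self (u : ℝ → ℂ) : weilPoleSesq u u = (weilPoleForm u : ℂ) := by
  unfold weilPoleSesq weilPoleForm
  rw [mul_assoc, mul_conj_eq_norm_sq, mul_assoc, mul_conj_eq_norm_sq]
  push_cast
  ring

/-- **The diagonal of the sesquilinear window form is the window form**:
`weilWindowSesq a u u = weilWindowForm a u` (no hypothesis on `u`). -/
theorem weilWindowSesq_self (a : ℝ) (u : ℝ → ℂ) :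
    weilWindowSesq a u u = (weilWindowForm a u : ℂ) := by
  unfold weilWindowSesq weilDirichletSesq weilWindowForm weilDirichletEnergy
  rw [weilPoleSesq_self]
  simp_rw [weilIncrementSesq_self]
  have harch : ∫ t in Ioi (0 : ℝ), (weilArchDensity t : ℂ) * (weilIncrement u t : ℂ) =
      ((∫ t in Ioi (0 : ℝ), weilArchDensity t * weilIncrement u t : ℝ) : ℂ) := by
    rw [← integral_complex_ofReal]
    exact integral_congr_ae (Eventually.of_forall fun t ↦ by push_cast; rfl)
  have hnorm : ∫ x : ℝ, u x * conj (u x) = ((∫ x : ℝ, ‖u x‖ ^ 2 : ℝ) : ℂ) := by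
    rw [← integral_complex_ofReal]
    exact integral_congr_ae (Eventually.of_forall fun x ↦ mul_conj_eq_norm_sq _)
  rw [harch, hnorm]
  push_cast
  ring

/-- `D_t(v, u) = conj D_t(u, v)` (no hypothesis). -/
theorem weilIncrementSesq_conj_symm (u v : ℝ → ℂ) (t : ℝ) :
    weilIncrementSesq v u t = conj (weilIncrementSesq u v t) := by
  unfold weilIncrementSesq
  rw [← integral_conj]
  refine integral_congr_ae (Eventually.of_forall fun x ↦ ?_)
  simp only [map_mul, Complex.conj_conj]
  ring

/-- `P(v, u) = conj P(u, v)` (no hypothesis). -/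
theorem weilPoleSesq_conj_symm (u v : ℝ → ℂ) : weilPoleSesq v u = conj (weilPoleSesq u v) := by
  unfold weilPoleSesq
  simp only [map_sub, map_mul, Complex.conj_conj, map_ofNat]
  ring

/-- **Hermitian symmetry**: `weilWindowSesq a v u = conj (weilWindowSesq a u v)` (no hypothesis). -/
theorem weilWindowSesq_conj_symm (a : ℝ) (u v : ℝ → ℂ) :
    weilWindowSesq a v u = conj (weilWindowSesq a u v) := by
  have hdiv : ∀ n : ℕ, conj (((Λ n : ℝ) / Real.sqrt n : ℂ)) = ((Λ n : ℝ) / Real.sqrt n : ℂ) := by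
    intro n
    rw [map_div₀, Complex.conj_ofReal, Complex.conj_ofReal]
  have hsum : ∑ n ∈ weilPrimeIndex a, ((Λ n : ℝ) / Real.sqrt n : ℂ) * weilIncrementSesq v u (Real.log n) =
      conj (∑ n ∈ weilPrimeIndex a, ((Λ n : ℝ) / Real.sqrt n : ℂ) * weilIncrementSesq u v (Real.log n)) := by
    rw [map_sum]
    refine Finset.sum_congr rfl fun n _ ↦ ?_
    rw [map_mul, hdiv, weilIncrementSesq_conj_symm]
  have harch : ∫ t in Ioi (0 : ℝ), (weilArchDensity t : ℂ) * weilIncrementSesq v u t =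
      conj (∫ t in Ioi (0 : ℝ), (weilArchDensity t : ℂ) * weilIncrementSesq u v t) := by
    rw [← integral_conj]
    refine integral_congr_ae (Eventually.of_forall fun t ↦ ?_)
    beta_reduce
    rw [map_mul, Complex.conj_ofReal, weilIncrementSesq_conj_symm]
  have hinner : ∫ x : ℝ, v x * conj (u x) = conj (∫ x : ℝ, u x * conj (v x)) := by
    rw [← integral_conj]
    refine integral_congr_ae (Eventually.of_forall fun x ↦ ?_)
    simp only [map_mul, Complex.conj_conj]
    ring
  unfold weilWindowSesq weilDirichletSesq
  rw [weilPoleSesq_conj_symm, hsum, harch, hinner]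
  simp only [map_add, map_sub, map_mul, Complex.conj_ofReal]

/-! ## Linearity in the first argument -/

/-- `D_t(c u, v) = c D_t(u, v)` (no hypothesis). -/
theorem weilIncrementSesq_smul_left (c : ℂ) (u v : ℝ → ℂ) (t : ℝ) :
    weilIncrementSesq (c • u) v t = c * weilIncrementSesq u v t := by
  unfold weilIncrementSesq
  rw [← integral_const_mul]
  refine integral_congr_ae (Eventually.of_forall fun x ↦ ?_)
  simp only [Pi.smul_apply, smul_eq_mul]
  ring

/-- `P(c u, v) = c P(u, v)` (no hypothesis). -/
theorem weilPoleSesq_smul_left (c : ℂ) (u v : ℝ → ℂ) :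
    weilPoleSesq (c • u) v = c * weilPoleSesq u v := by
  unfold weilPoleSesq
  have h1 : ∫ x : ℝ, (c • u) x * (Real.cosh (x / 2) : ℂ) = c * ∫ x : ℝ, u x * (Real.cosh (x / 2) : ℂ) := by
    rw [← integral_const_mul]
    refine integral_congr_ae (Eventually.of_forall fun x ↦ ?_)
    simp only [Pi.smul_apply, smul_eq_mul, mul_assoc]
  have h2 : ∫ x : ℝ, (c • u) x * (Real.sinh (x / 2) : ℂ) = c * ∫ x : ℝ, u x * (Real.sinh (x / 2) : ℂ) := by
    rw [← integral_const_mul]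
    refine integral_congr_ae (Eventually.of_forall fun x ↦ ?_)
    simp only [Pi.smul_apply, smul_eq_mul, mul_assoc]
  rw [h1, h2]
  ring

/-- **Homogeneity**: `weilWindowSesq a (c • u) v = c · weilWindowSesq a u v` (no hypothesis). -/
theorem weilWindowSesq_smul_left (a : ℝ) (c : ℂ) (u v : ℝ → ℂ) :
    weilWindowSesq a (c • u) v = c * weilWindowSesq a u v := by
  unfold weilWindowSesq weilDirichletSesq
  rw [weilPoleSesq_smul_left]
  simp_rw [weilIncrementSesq_smul_left]
  have harch : ∫ t in Ioi (0 : ℝ), (weilArchDensity t : ℂ) * (c * weilIncrementSesq u v t) =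
      c * ∫ t in Ioi (0 : ℝ), (weilArchDensity t : ℂ) * weilIncrementSesq u v t := by
    rw [← integral_const_mul]
    exact integral_congr_ae (Eventually.of_forall fun t ↦ by ring)
  have hinner : ∫ x : ℝ, (c • u) x * conj (v x) = c * ∫ x : ℝ, u x * conj (v x) := by
    rw [← integral_const_mul]
    refine integral_congr_ae (Eventually.of_forall fun x ↦ ?_)
    simp only [Pi.smul_apply, smul_eq_mul, mul_assoc]
  have hsum : ∑ n ∈ weilPrimeIndex a, ((Λ n : ℝ) / Real.sqrt n : ℂ) * (c * weilIncrementSesq u v (Real.log n)) =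
      c * ∑ n ∈ weilPrimeIndex a, ((Λ n : ℝ) / Real.sqrt n : ℂ) * weilIncrementSesq u v (Real.log n) := by
    rw [Finset.mul_sum]
    exact Finset.sum_congr rfl fun n _ ↦ by ring
  rw [harch, hinner, hsum]
  ring

/-- `D_t(u₁ + u₂, v) = D_t(u₁, v) + D_t(u₂, v)` for window functions. -/
theorem weilIncrementSesq_add_left (hu₁ : IsWindowFunction a u₁) (hu₂ : IsWindowFunction a u₂)
    (hv : IsWindowFunction a v) (t : ℝ) :
    weilIncrementSesq (u₁ + u₂) v t = weilIncrementSesq u₁ v t + weilIncrementSesq u₂ v t := by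
  unfold weilIncrementSesq
  rw [← integral_add (hu₁.integrable_incrementSesq hv t) (hu₂.integrable_incrementSesq hv t)]
  refine integral_congr_ae (Eventually.of_forall fun x ↦ ?_)
  simp only [Pi.add_apply]
  ring

/-- `P(u₁ + u₂, v) = P(u₁, v) + P(u₂, v)` for window functions. -/
theorem weilPoleSesq_add_left (hu₁ : IsWindowFunction a u₁) (hu₂ : IsWindowFunction a u₂)
    (v : ℝ → ℂ) : weilPoleSesq (u₁ + u₂) v = weilPoleSesq u₁ v + weilPoleSesq u₂ v := by
  have hc : Continuous fun x : ℝ ↦ ((Real.cosh (x / 2) : ℝ) : ℂ) :=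
    Complex.continuous_ofReal.comp (Real.continuous_cosh.comp (continuous_id.div_const 2))
  have hs : Continuous fun x : ℝ ↦ ((Real.sinh (x / 2) : ℝ) : ℂ) :=
    Complex.continuous_ofReal.comp (Real.continuous_sinh.comp (continuous_id.div_const 2))
  unfold weilPoleSesq
  have h1 : ∫ x : ℝ, (u₁ + u₂) x * (Real.cosh (x / 2) : ℂ) =
      (∫ x : ℝ, u₁ x * (Real.cosh (x / 2) : ℂ)) + ∫ x : ℝ, u₂ x * (Real.cosh (x / 2) : ℂ) := by
    rw [← integral_add (hu₁.integrable_mul_continuous hc) (hu₂.integrable_mul_continuous hc)]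
    exact integral_congr_ae (Eventually.of_forall fun x ↦ by simp only [Pi.add_apply, add_mul])
  have h2 : ∫ x : ℝ, (u₁ + u₂) x * (Real.sinh (x / 2) : ℂ) =
      (∫ x : ℝ, u₁ x * (Real.sinh (x / 2) : ℂ)) + ∫ x : ℝ, u₂ x * (Real.sinh (x / 2) : ℂ) := by
    rw [← integral_add (hu₁.integrable_mul_continuous hs) (hu₂.integrable_mul_continuous hs)]
    exact integral_congr_ae (Eventually.of_forall fun x ↦ by simp only [Pi.add_apply, add_mul])
  rw [h1, h2]
  ring

/-- **Additivity in the first argument** for window functions (`a ≥ 0`):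
`weilWindowSesq b (u₁ + u₂) v = weilWindowSesq b u₁ v + weilWindowSesq b u₂ v`. -/
theorem weilWindowSesq_add_left (ha : 0 ≤ a) (hu₁ : IsWindowFunction a u₁)
    (hu₂ : IsWindowFunction a u₂) (hv : IsWindowFunction a v) (b : ℝ) :
    weilWindowSesq b (u₁ + u₂) v = weilWindowSesq b u₁ v + weilWindowSesq b u₂ v := by
  unfold weilWindowSesq weilDirichletSesq
  rw [weilPoleSesq_add_left hu₁ hu₂]
  simp_rw [weilIncrementSesq_add_left hu₁ hu₂ hv]
  have harch : ∫ t in Ioi (0 : ℝ), (weilArchDensity t : ℂ) *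
      (weilIncrementSesq u₁ v t + weilIncrementSesq u₂ v t) =
      (∫ t in Ioi (0 : ℝ), (weilArchDensity t : ℂ) * weilIncrementSesq u₁ v t) +
        ∫ t in Ioi (0 : ℝ), (weilArchDensity t : ℂ) * weilIncrementSesq u₂ v t := by
    rw [← integral_add (integrableOn_weilArchDensity_mul_weilIncrementSesq ha hu₁ hv)
      (integrableOn_weilArchDensity_mul_weilIncrementSesq ha hu₂ hv)]
    exact integral_congr_ae (Eventually.of_forall fun t ↦ mul_add _ _ _)
  have hinner : ∫ x : ℝ, (u₁ + u₂) x * conj (v x) =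
      (∫ x : ℝ, u₁ x * conj (v x)) + ∫ x : ℝ, u₂ x * conj (v x) := by
    rw [← integral_add (hu₁.integrable_mul_conj hv) (hu₂.integrable_mul_conj hv)]
    exact integral_congr_ae (Eventually.of_forall fun x ↦ by simp only [Pi.add_apply, add_mul])
  have hsum : ∑ n ∈ weilPrimeIndex b, ((Λ n : ℝ) / Real.sqrt n : ℂ) *
      (weilIncrementSesq u₁ v (Real.log n) + weilIncrementSesq u₂ v (Real.log n)) =
      (∑ n ∈ weilPrimeIndex b, ((Λ n : ℝ) / Real.sqrt n : ℂ) * weilIncrementSesq u₁ v (Real.log n)) +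
        ∑ n ∈ weilPrimeIndex b, ((Λ n : ℝ) / Real.sqrt n : ℂ) * weilIncrementSesq u₂ v (Real.log n) := by
    rw [← Finset.sum_add_distrib]
    exact Finset.sum_congr rfl fun n _ ↦ mul_add _ _ _
  rw [harch, hinner, hsum]
  ring

end Summit.RiemannHypothesis.RiemannHypothesis.Theorems.WeilFormatC

end
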